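import Mathlib.Analysis.SpecialFunctions.Sqrt
import Literature.Analysis.FluidPDE.ElgindiWeightedIBP
import HarnessLib

/-!
# The `√R` (Liouville) transform of the Grad–Shafranov energy: radial-line identity

Topic `Literature/MathematicalPhysics/MHD`. The Grad–Shafranov operator
`Δ*ψ = R∂_R(R⁻¹∂_Rψ) + ∂²_Zψ` (Freidberg, *Ideal MHD* (2014) eq. (6.7); `GradShafranov.gsOperator`)
is symmetric in `L²(Ω; R⁻¹dRdZ)` with Dirichlet form `a(u,u) = ∫_Ω R⁻¹|∇u|²` and mass
`b(u,u) = ∫_Ω R⁻¹u²`. The classical Liouville substitution `u = √R·w` removes the weight: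
`∫R⁻¹u² = ∫w²` and
`∫_Ω R⁻¹|∇(√R w)|² dRdZ = ∫_Ω |∇w|² dRdZ + (3/4)∫_Ω R⁻² w² dRdZ`  (`w` vanishing on `∂Ω`, `Ω ⊂ {R > 0}`),
so that `λ_k(−Δ*; Ω, R⁻¹dRdZ) = λ_k(−Δ + 3/(4R²); Ω, dRdZ)` — the reduction used by the certnum
validated-eigenvalue chain for `−Δ*` (seat certnum-ode-3, «gs2»; statement S-TRANS-1 of
pub/certnum/ode/DESIGN-pde.md §6). Pointwise, `R⁻¹(∂_R(√R w))² = (∂_R w)² + R⁻¹w∂_Rw + ¼R⁻²w²` and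
`R⁻¹(∂_Z(√R w))² = (∂_Z w)²`; the only non-algebraic step is the integration by parts
`∫ R⁻¹ w ∂_R w dR = ½∫ R⁻² w² dR` along each radial line. This file PROVES that one-dimensional core
for `v ∈ C¹(ℝ)` compactly supported inside `(0, ∞)`:

* `deriv_sqrt_mul` — `(√x·v)′ = v/(2√x) + √x·v′` for `x > 0`;
* `inv_mul_sq_deriv_sqrt_mul` — the pointwise identity
  `x⁻¹((√x·v)′)² = v′² + x⁻¹v′v + ¼x⁻²v²` for `x > 0`;
* `integral_Ioi_inv_mul_deriv_mul` — `∫₀^∞ x⁻¹ v′ v = ½∫₀^∞ x⁻² v²` (from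
  `Literature.Analysis.FluidPDE.Elgindi.integral_Ioi_neg_weight_mul_deriv_mul` with `N = −x⁻¹`);
* `integral_Ioi_inv_mul_sq_deriv_sqrt_mul` — **the radial-line energy identity**
  `∫₀^∞ x⁻¹((√x·v)′)² dx = ∫₀^∞ (v′)² dx + (3/4)∫₀^∞ x⁻² v² dx`.

The two-dimensional identity follows by integrating over `Z` (Fubini) for `w ∈ C¹_c(Ω)`, and for
`w ∈ H¹₀(Ω)` by density — both left as prose here (Mathlib has no Sobolev spaces on domains; the
certnum chain states them as the client's hypothesis H-SPEC side). WHAT THIS IS NOT: not the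
operator identity `Δ*(√R w) = √R(Δw − 3w/(4R²))` for `C²` functions (not needed by the energy route);
not a statement about eigenvalues (that is the operator-free Liu / Birman–Schwinger layer,
`Literature/Analysis/OperatorTheory/{ProjectionLowerBound, BirmanSchwingerCount}.lean`). Everything
is PROVED; no named facts. SOURCE: this is the LIOUVILLE TRANSFORMATION of the radial Sturm–Liouville
part `−(R⁻¹y′)′ = λR⁻¹y` of `−Δ*` (coefficients `p = w = 1/R`, `q = 0`): W. N. Everitt, *A catalogue of
Sturm–Liouville differential equations*, §7 «The Liouville transformation», in Amrein–Hinz–Pearson (eds.),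
*Sturm–Liouville Theory: Past and Present* (Birkhäuser 2005) — with `w/p = 1` the independent variable is
unchanged, `Y = (pw)^{1/4}y = R^{-1/2}y` (i.e. `y = √R·Y`) and the new coefficient is
`Q = w⁻¹q − (w⁻³p)^{1/4}(p((pw)^{-1/4})′)′ = 3/(4R²)`; the theorems below are the energy (weak-form)
version of that statement, which is what a form-domain (`H¹₀`) eigenvalue argument consumes.
[cite: Everitt2005SLCatalogue, §7 (The Liouville transformation), with p = w = 1/R, q = 0]
-/

noncomputable section

open MeasureTheory Set Real Filter
open _root_.Topology

namespace Literature.MathematicalPhysics.MHD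

namespace GradShafranovSqrt

open Literature.Analysis.FluidPDE.Elgindi

/-- `(√x·v)′(x) = v(x)/(2√x) + √x·v′(x)` for `x > 0` and `v` differentiable at `x` (the Liouville change of
dependent variable `y = (pw)^{-1/4}Y = √x·Y` for `p = w = 1/x`). [cite: Everitt2005SLCatalogue, §7 (ii)] -/
theorem deriv_sqrt_mul {v : ℝ → ℝ} {x : ℝ} (hx : 0 < x) (hv : DifferentiableAt ℝ v x) :
    deriv (fun y => √y * v y) x = v x / (2 * √x) + √x * deriv v x := by
  have h1 : HasDerivAt (fun y => √y) (1 / (2 * √x)) x := Real.hasDerivAt_sqrt hx.ne'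
  have h2 : HasDerivAt v (deriv v x) x := hv.hasDerivAt
  rw [(h1.fun_mul h2).deriv]
  ring

/-- Algebraic core of the Liouville substitution in the variable `s = √x > 0`:
`s⁻²(a/(2s) + s b)² = b² + s⁻² b a + ¼ s⁻⁴ a²` (private helper). [folklore] -/
private theorem liouville_sq_identity (s a b : ℝ) (hs : 0 < s) :
    (s ^ 2)⁻¹ * (a / (2 * s) + s * b) ^ 2 =
      b ^ 2 + ((s ^ 2)⁻¹ * b * a + (1 / 4) * (((s ^ 2) ^ 2)⁻¹ * a ^ 2)) := by
  have hs0 : s ≠ 0 := hs.ne'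
  field_simp
  ring

/-- **Pointwise identity** `x⁻¹((√x·v)′)² = (v′)² + x⁻¹ v′ v + ¼ x⁻² v²` for `x > 0`
(`v` differentiable at `x`): the energy density of `p y′² = x⁻¹y′²` under `y = √x·v`, whose last term
is Everitt's new coefficient `Q = 3/(4x²)` once the middle term is integrated by parts.
[cite: Everitt2005SLCatalogue, §7 (Q for p = w = 1/x, q = 0)] -/
theorem inv_mul_sq_deriv_sqrt_mul {v : ℝ → ℝ} {x : ℝ} (hx : 0 < x) (hv : DifferentiableAt ℝ v x) :
    x⁻¹ * deriv (fun y => √y * v y) x ^ 2 =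
      deriv v x ^ 2 + (x⁻¹ * deriv v x * v x + (1 / 4) * ((x ^ 2)⁻¹ * v x ^ 2)) := by
  rw [deriv_sqrt_mul hx hv]
  have hsq : √x ^ 2 = x := Real.sq_sqrt hx.le
  have key := liouville_sq_identity (√x) (v x) (deriv v x) (Real.sqrt_pos.mpr hx)
  simpa only [hsq] using key

/-- **`∫₀^∞ x⁻¹ v′ v dx = ½ ∫₀^∞ x⁻² v² dx`** for `v ∈ C¹(ℝ)` compactly supported inside `(0,∞)`
(integration by parts of `(x⁻¹ v²/2)′`; the weight `−x⁻¹` in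
`Elgindi.integral_Ioi_neg_weight_mul_deriv_mul`) — the step turning the cross term of the Liouville
substitution into the potential `Q`. [cite: Everitt2005SLCatalogue, §7 (p = w = 1/x)] -/
theorem integral_Ioi_inv_mul_deriv_mul {v : ℝ → ℝ} (hv : ContDiff ℝ 1 v) (hs : HasCompactSupport v)
    (hsub : tsupport v ⊆ Ioi 0) :
    ∫ x in Ioi (0 : ℝ), x⁻¹ * deriv v x * v x = (1 / 2) * ∫ x in Ioi (0 : ℝ), (x ^ 2)⁻¹ * v x ^ 2 := by
  have hN : ContDiffOn ℝ 1 (fun x : ℝ => -x⁻¹) (Ioi 0) :=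
    (contDiffOn_id.inv fun x hx => ne_of_gt hx).neg
  have h := integral_Ioi_neg_weight_mul_deriv_mul (N := fun x : ℝ => -x⁻¹) hN hv hs hsub
  have e1 : ∫ x in Ioi (0 : ℝ), -(-x⁻¹ * deriv v x) * v x = ∫ x in Ioi (0 : ℝ), x⁻¹ * deriv v x * v x :=
    integral_congr_ae (ae_of_all _ fun x => by ring)
  have e2 : ∫ x in Ioi (0 : ℝ), deriv (fun x : ℝ => -x⁻¹) x * v x ^ 2 =
      ∫ x in Ioi (0 : ℝ), (x ^ 2)⁻¹ * v x ^ 2 := by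
    refine setIntegral_congr_fun measurableSet_Ioi fun x hx => ?_
    have hx0 : (x : ℝ) ≠ 0 := ne_of_gt hx
    have hd : HasDerivAt (fun y : ℝ => -y⁻¹) ((x ^ 2)⁻¹) x := by
      simpa using (hasDerivAt_inv hx0).fun_neg
    rw [hd.deriv]
  rw [← e1, h, e2]

/-- **Radial-line energy identity of the `√R` transform.** For `v ∈ C¹(ℝ)` with compact support
inside `(0, ∞)`:  `∫₀^∞ x⁻¹((√x·v)′)² dx = ∫₀^∞ (v′)² dx + (3/4)·∫₀^∞ x⁻² v² dx`. Integrated over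
`Z` this is `∫R⁻¹|∇(√R w)|² = ∫|∇w|² + ¾∫R⁻²w²` (the `Z`-part being pointwise), i.e. `−Δ*` in
`L²(R⁻¹dRdZ)` is unitarily equivalent to `−Δ + 3/(4R²)` in flat `L²` on domains in `{R > 0}`
(statement S-TRANS-1 of the certnum −Δ* eigenvalue chain): the weak form of Everitt's Liouville normal form
`−Y″ + (3/(4x²))Y = λY` of `−(x⁻¹y′)′ = λx⁻¹y`. [cite: Everitt2005SLCatalogue, §7 (The Liouville transformation; p = w = 1/x, q = 0, Q = 3/(4x²))] -/
theorem integral_Ioi_inv_mul_sq_deriv_sqrt_mul {v : ℝ → ℝ} (hv : ContDiff ℝ 1 v)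
    (hs : HasCompactSupport v) (hsub : tsupport v ⊆ Ioi 0) :
    ∫ x in Ioi (0 : ℝ), x⁻¹ * deriv (fun y => √y * v y) x ^ 2 =
      (∫ x in Ioi (0 : ℝ), deriv v x ^ 2) + (3 / 4) * ∫ x in Ioi (0 : ℝ), (x ^ 2)⁻¹ * v x ^ 2 := by
  obtain ⟨a, ha, hva⟩ := exists_pos_forall_lt_eq_zero' hs hsub
  have hdv : Differentiable ℝ v := hv.differentiable (by simp)
  have hvc : Continuous v := hv.continuous
  have hdvc : Continuous (deriv v) := hv.continuous_deriv le_rfl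
  have hdva : ∀ x, x < a → deriv v x = 0 := fun x hx => by
    have : v =ᶠ[𝓝 x] fun _ => 0 := Filter.eventuallyEq_of_mem (Iio_mem_nhds hx) fun y hy => hva y hy
    rw [this.deriv_eq, deriv_const]
  -- rewrite the integrand on `(0, ∞)`
  have hpt : ∀ x ∈ Ioi (0 : ℝ), x⁻¹ * deriv (fun y => √y * v y) x ^ 2 =
      deriv v x ^ 2 + (x⁻¹ * deriv v x * v x + (1 / 4) * ((x ^ 2)⁻¹ * v x ^ 2)) :=
    fun x hx => inv_mul_sq_deriv_sqrt_mul hx (hdv x)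
  rw [setIntegral_congr_fun measurableSet_Ioi hpt]
  -- integrability of the three pieces (continuous with compact support on `ℝ`: `v = 0` below `a`)
  have i1 : Integrable fun x => deriv v x ^ 2 := by
    have hc : Continuous fun x => deriv v x ^ 2 := hdvc.pow 2
    have hsupp : HasCompactSupport fun x => deriv v x ^ 2 := by
      have : (fun x => deriv v x ^ 2) = fun x => deriv v x * deriv v x := by funext x; ring
      rw [this]; exact hs.deriv.mul_left
    exact hc.integrable_of_hasCompactSupport hsupp
  have i2 : Integrable fun x : ℝ => x⁻¹ * deriv v x * v x := by
    have hM : ContDiffOn ℝ 0 (fun x : ℝ => x⁻¹) (Ioi 0) := contDiffOn_id.inv fun x hx => ne_of_gt hx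
    have hg : ContDiff ℝ 0 fun x => deriv v x * v x :=
      contDiff_zero.2 (show Continuous (fun x => deriv v x * v x) from hdvc.mul hvc)
    have hc := (contDiff_weight_mul (n := 0) hM hg ha (fun x hx => by simp [hva x hx])).continuous
    have hc' : Continuous fun x : ℝ => x⁻¹ * deriv v x * v x :=
      hc.congr fun x => by ring
    exact hc'.integrable_of_hasCompactSupport hs.mul_left
  have i3 : Integrable fun x : ℝ => (x ^ 2)⁻¹ * v x ^ 2 := by
    have hM : ContDiffOn ℝ 0 (fun x : ℝ => (x ^ 2)⁻¹) (Ioi 0) :=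
      (contDiffOn_id.pow 2).inv fun x hx => pow_ne_zero 2 (ne_of_gt hx)
    have hg : ContDiff ℝ 0 fun x => v x ^ 2 := contDiff_zero.2 (show Continuous (fun x => v x ^ 2) from hvc.pow 2)
    have hc := (contDiff_weight_mul (n := 0) hM hg ha (fun x hx => by simp [hva x hx])).continuous
    have hsupp : HasCompactSupport fun x : ℝ => (x ^ 2)⁻¹ * v x ^ 2 := by
      have : (fun x : ℝ => (x ^ 2)⁻¹ * v x ^ 2) = fun x => ((x ^ 2)⁻¹ * v x) * v x := by funext x; ring
      rw [this]; exact hs.mul_left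
    exact hc.integrable_of_hasCompactSupport hsupp
  have i23 : Integrable fun x : ℝ => x⁻¹ * deriv v x * v x + (1 / 4) * ((x ^ 2)⁻¹ * v x ^ 2) :=
    i2.add (i3.const_mul (1 / 4))
  rw [integral_add i1.integrableOn i23.integrableOn, integral_add i2.integrableOn (i3.const_mul (1 / 4)).integrableOn,
    integral_const_mul, integral_Ioi_inv_mul_deriv_mul hv hs hsub]
  ring

/-- **Slice form of the two-dimensional identity.** For a fixed height `z`, let the radial slice
`r ↦ w(r, z)` be `C¹` with compact support inside `(0,∞)`, and let `w(r, ·)` be differentiable at `z`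
for every `r` with `r ↦ (∂_Z w)(r,z)²` integrable on `(0,∞)`. Then, with `u = √R·w`,
`∫₀^∞ R⁻¹((∂_R u)² + (∂_Z u)²) dR = ∫₀^∞ ((∂_R w)² + (∂_Z w)²) dR + (3/4)∫₀^∞ R⁻² w² dR` at that `z`
(the `Z`-part is pointwise: `R⁻¹(∂_Z(√R·w))² = (∂_Z w)²`). Integrating over `z` gives
`∫_Ω R⁻¹|∇u|² = ∫_Ω |∇w|² + (3/4)∫_Ω R⁻²w²` for `w ∈ C¹_c(Ω)`, `Ω ⊂ {R > 0}` — the energy identity behind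
`λ_k(−Δ*; Ω, R⁻¹dRdZ) = λ_k(−Δ + 3/(4R²); Ω)`; the weak/`H¹₀` form follows by density (prose).
[cite: Everitt2005SLCatalogue, §7 (The Liouville transformation; p = w = 1/R, q = 0, Q = 3/(4R²))] -/
theorem integral_Ioi_gradSq_sqrt_mul_slice {w : ℝ → ℝ → ℝ} {z : ℝ}
    (hw : ContDiff ℝ 1 fun r => w r z) (hs : HasCompactSupport fun r => w r z)
    (hsub : tsupport (fun r => w r z) ⊆ Ioi 0)
    (hwz : ∀ r, DifferentiableAt ℝ (fun z' => w r z') z)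
    (hiz : IntegrableOn (fun r => deriv (fun z' => w r z') z ^ 2) (Ioi 0)) :
    ∫ r in Ioi (0 : ℝ), r⁻¹ * (deriv (fun y => √y * w y z) r ^ 2 + deriv (fun z' => √r * w r z') z ^ 2) =
      (∫ r in Ioi (0 : ℝ), (deriv (fun y => w y z) r ^ 2 + deriv (fun z' => w r z') z ^ 2))
        + (3 / 4) * ∫ r in Ioi (0 : ℝ), (r ^ 2)⁻¹ * w r z ^ 2 := by
  -- the `Z`-part is pointwise: r⁻¹ (√r ∂_z w)² = (∂_z w)² for r > 0
  have hzpt : ∀ r ∈ Ioi (0 : ℝ),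
      r⁻¹ * (deriv (fun y => √y * w y z) r ^ 2 + deriv (fun z' => √r * w r z') z ^ 2)
        = r⁻¹ * deriv (fun y => √y * w y z) r ^ 2 + deriv (fun z' => w r z') z ^ 2 := by
    intro r hr
    have hr0 : (0 : ℝ) < r := hr
    have hdz : deriv (fun z' => √r * w r z') z = √r * deriv (fun z' => w r z') z := by
      rw [deriv_const_mul _ (hwz r)]
    have hsq : √r ^ 2 = r := Real.sq_sqrt hr0.le
    rw [hdz, mul_pow, hsq]
    field_simp
  rw [setIntegral_congr_fun measurableSet_Ioi hzpt]
  -- integrability of the radial energy density, through the pointwise Liouville identity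
  obtain ⟨a, ha, hva⟩ := exists_pos_forall_lt_eq_zero' hs hsub
  have hva' : ∀ x, x < a → w x z = 0 := fun x hx => by simpa using hva x hx
  have hdv : Differentiable ℝ (fun y => w y z) := hw.differentiable (by simp)
  have hvc : Continuous (fun y => w y z) := hw.continuous
  have hdvc : Continuous (deriv fun y => w y z) := hw.continuous_deriv le_rfl
  have hrad_eq : ∀ r ∈ Ioi (0 : ℝ), r⁻¹ * deriv (fun y => √y * w y z) r ^ 2 =
      deriv (fun y => w y z) r ^ 2 + (r⁻¹ * deriv (fun y => w y z) r * w r z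
        + (1 / 4) * ((r ^ 2)⁻¹ * w r z ^ 2)) :=
    fun r hr => by simpa using inv_mul_sq_deriv_sqrt_mul (v := fun y => w y z) hr (hdv r)
  have i1 : Integrable fun r => deriv (fun y => w y z) r ^ 2 := by
    have hsupp : HasCompactSupport fun r => deriv (fun y => w y z) r ^ 2 := by
      have : (fun r => deriv (fun y => w y z) r ^ 2) = fun r => deriv (fun y => w y z) r * deriv (fun y => w y z) r := by
        funext r; ring
      rw [this]; exact hs.deriv.mul_left
    exact (hdvc.pow 2).integrable_of_hasCompactSupport hsupp
  have i2 : Integrable fun r : ℝ => r⁻¹ * deriv (fun y => w y z) r * w r z := by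
    have hM : ContDiffOn ℝ 0 (fun r : ℝ => r⁻¹) (Ioi 0) := contDiffOn_id.inv fun r hr => ne_of_gt hr
    have hg : ContDiff ℝ 0 fun r => deriv (fun y => w y z) r * w r z :=
      contDiff_zero.2 (show Continuous (fun r => deriv (fun y => w y z) r * w r z) from hdvc.mul hvc)
    have hc := (contDiff_weight_mul (n := 0) hM hg ha (fun r hr => by simp [hva' r hr])).continuous
    exact (hc.congr fun r => by ring).integrable_of_hasCompactSupport hs.mul_left
  have i3 : Integrable fun r : ℝ => (r ^ 2)⁻¹ * w r z ^ 2 := by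
    have hM : ContDiffOn ℝ 0 (fun r : ℝ => (r ^ 2)⁻¹) (Ioi 0) :=
      (contDiffOn_id.pow 2).inv fun r hr => pow_ne_zero 2 (ne_of_gt hr)
    have hg : ContDiff ℝ 0 fun r => w r z ^ 2 := contDiff_zero.2 (show Continuous (fun r => w r z ^ 2) from hvc.pow 2)
    have hc := (contDiff_weight_mul (n := 0) hM hg ha (fun r hr => by simp [hva' r hr])).continuous
    have hsupp : HasCompactSupport fun r : ℝ => (r ^ 2)⁻¹ * w r z ^ 2 := by
      have : (fun r : ℝ => (r ^ 2)⁻¹ * w r z ^ 2) = fun r => ((r ^ 2)⁻¹ * w r z) * w r z := by funext r; ring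
      rw [this]; exact hs.mul_left
    exact hc.integrable_of_hasCompactSupport hsupp
  have irad : IntegrableOn (fun r : ℝ => r⁻¹ * deriv (fun y => √y * w y z) r ^ 2) (Ioi 0) := by
    have i123 : Integrable fun r : ℝ => deriv (fun y => w y z) r ^ 2
        + (r⁻¹ * deriv (fun y => w y z) r * w r z + (1 / 4) * ((r ^ 2)⁻¹ * w r z ^ 2)) :=
      i1.add (i2.add (i3.const_mul (1 / 4)))
    exact (integrableOn_congr_fun hrad_eq measurableSet_Ioi).mpr i123.integrableOn
  -- split, apply the radial-line identity, regroup
  rw [integral_add irad hiz, integral_Ioi_inv_mul_sq_deriv_sqrt_mul hw hs hsub,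
    integral_add i1.integrableOn hiz]
  ring

/-- **The `√R` energy identity, integrated over `Z` (S-TRANS-1, two-dimensional form for `w ∈ C¹_c`).**
Let `w : ℝ × ℝ → ℝ` (written curried, `w r z`) be `C¹` with compact support inside the open right
half-plane `{R > 0}`. Then, with `u = √R·w` and iterated integrals `∫ dZ ∫₀^∞ dR`,
`∫∫ R⁻¹((∂_R u)² + (∂_Z u)²) = ∫∫ ((∂_R w)² + (∂_Z w)²) + (3/4)∫∫ R⁻² w²` — i.e.
`∫_Ω R⁻¹|∇(√R w)|² dR dZ = ∫_Ω |∇w|² dR dZ + (3/4)∫_Ω R⁻² w² dR dZ` for `w ∈ C¹_c(Ω)`, `Ω ⊂ {R > 0}`: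
the slice identity `integral_Ioi_gradSq_sqrt_mul_slice` at every `z` (its hypotheses follow from joint
`C¹` regularity and compact support), then linearity of the `Z`-integral, for which the two right-hand
`Z`-integrands are continuous with compact support (parametric integrals of continuous integrands over a
fixed compact `R`-interval `[a, b] ⊂ (0, ∞)` containing the radial projection of the support). This is the
energy form of the Liouville transformation `y = √R·Y`, `Q = 3/(4R²)` of the radial part of `−Δ*`; the
`H¹₀(Ω)` statement follows by density (prose; no Sobolev spaces on domains in Mathlib).
[cite: Everitt2005SLCatalogue, §7 (The Liouville transformation; p = w = 1/R, q = 0, Q = 3/(4R²))] -/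
theorem integral_integral_Ioi_gradSq_sqrt_mul {w : ℝ → ℝ → ℝ}
    (hw : ContDiff ℝ 1 (Function.uncurry w)) (hs : HasCompactSupport (Function.uncurry w))
    (hsub : tsupport (Function.uncurry w) ⊆ {p | 0 < p.1}) :
    ∫ z, ∫ r in Ioi (0 : ℝ), r⁻¹ * (deriv (fun y => √y * w y z) r ^ 2 + deriv (fun z' => √r * w r z') z ^ 2) =
      (∫ z, ∫ r in Ioi (0 : ℝ), (deriv (fun y => w y z) r ^ 2 + deriv (fun z' => w r z') z ^ 2))
        + (3 / 4) * ∫ z, ∫ r in Ioi (0 : ℝ), (r ^ 2)⁻¹ * w r z ^ 2 := by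
  set W : ℝ × ℝ → ℝ := Function.uncurry w with hWdef
  have hdiff : Differentiable ℝ W := hw.differentiable (by simp)
  have hfdc : Continuous (fderiv ℝ W) := hw.continuous_fderiv (by simp)
  -- radial and vertical projections of the support
  set Kr : Set ℝ := Prod.fst '' tsupport W with hKr
  set Kz : Set ℝ := Prod.snd '' tsupport W with hKz
  have hKrc : IsCompact Kr := hs.isCompact.image continuous_fst
  have hKzc : IsCompact Kz := hs.isCompact.image continuous_snd
  have hKr0 : Kr ⊆ Ioi 0 := by
    rintro _ ⟨p, hp, rfl⟩; exact hsub hp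
  -- off the support everything vanishes
  have hW0 : ∀ r z, (r, z) ∉ tsupport W → w r z = 0 := fun r z h =>
    (image_eq_zero_of_notMem_tsupport h : W (r, z) = 0)
  have hfd0 : ∀ r z, (r, z) ∉ tsupport W → fderiv ℝ W (r, z) = 0 := fun r z h =>
    image_eq_zero_of_notMem_tsupport fun h' => h (tsupport_fderiv_subset ℝ h')
  have hnotr : ∀ r z, r ∉ Kr → (r, z) ∉ tsupport W := fun r z hr h => hr ⟨(r, z), h, rfl⟩
  have hnotz : ∀ r z, z ∉ Kz → (r, z) ∉ tsupport W := fun r z hz h => hz ⟨(r, z), h, rfl⟩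
  -- the partial derivatives as Fréchet derivatives
  have hdr : ∀ r z, deriv (fun y => w y z) r = fderiv ℝ W (r, z) (1, 0) := by
    intro r z
    have h := (hdiff (r, z)).hasFDerivAt.comp_hasDerivAt r
      ((hasDerivAt_id r).prodMk (hasDerivAt_const r z))
    exact h.deriv
  have hdz : ∀ r z, deriv (fun z' => w r z') z = fderiv ℝ W (r, z) (0, 1) := by
    intro r z
    have h := (hdiff (r, z)).hasFDerivAt.comp_hasDerivAt z
      ((hasDerivAt_const z r).prodMk (hasDerivAt_id z))
    exact h.deriv
  -- slice hypotheses, for every z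
  have hsliceC : ∀ z, ContDiff ℝ 1 fun r => w r z := fun z => hw.comp (contDiff_prodMk_left z)
  have hsliceS : ∀ z, HasCompactSupport fun r => w r z := fun z =>
    HasCompactSupport.intro hKrc fun r hr => hW0 r z (hnotr r z hr)
  have hsliceT : ∀ z, tsupport (fun r => w r z) ⊆ Ioi 0 := by
    intro z
    refine (closure_minimal ?_ hKrc.isClosed).trans hKr0
    intro r hr
    by_contra h
    exact hr (hW0 r z (hnotr r z h))
  have hsliceD : ∀ z r, DifferentiableAt ℝ (fun z' => w r z') z := fun z r =>
    (hdiff (r, z)).comp z ((differentiableAt_const _).prodMk differentiableAt_id)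
  -- the three z-integrands, as functions on ℝ × ℝ (argument order (z, r) for the parametric-integral lemma)
  set FA : ℝ → ℝ → ℝ := fun z r => (fderiv ℝ W (r, z) (1, 0)) ^ 2 + (fderiv ℝ W (r, z) (0, 1)) ^ 2 with hFA
  have hFAc : Continuous (Function.uncurry FA) := by
    have h1 : Continuous fun p : ℝ × ℝ => fderiv ℝ W (p.2, p.1) :=
      hfdc.comp (continuous_snd.prodMk continuous_fst)
    have h10 : Continuous fun p : ℝ × ℝ => fderiv ℝ W (p.2, p.1) (1, 0) := h1.clm_apply continuous_const
    have h01 : Continuous fun p : ℝ × ℝ => fderiv ℝ W (p.2, p.1) (0, 1) := h1.clm_apply continuous_const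
    exact (h10.pow 2).add (h01.pow 2)
  have hsliceI : ∀ z, IntegrableOn (fun r => deriv (fun z' => w r z') z ^ 2) (Ioi 0) := by
    intro z
    have hc : Continuous fun r => fderiv ℝ W (r, z) (0, 1) :=
      (hfdc.comp (continuous_id.prodMk continuous_const)).clm_apply continuous_const
    have hcs : HasCompactSupport fun r => (fderiv ℝ W (r, z) (0, 1)) ^ 2 :=
      HasCompactSupport.intro hKrc fun r hr => by simp [hfd0 r z (hnotr r z hr)]
    have hi : Integrable (fun r => (fderiv ℝ W (r, z) (0, 1)) ^ 2) :=
      (hc.pow 2).integrable_of_hasCompactSupport hcs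
    exact hi.integrableOn.congr_fun (fun r _ => by simp [hdz r z]) measurableSet_Ioi
  -- apply the slice identity at every z
  have hslice : ∀ z,
      ∫ r in Ioi (0 : ℝ), r⁻¹ * (deriv (fun y => √y * w y z) r ^ 2 + deriv (fun z' => √r * w r z') z ^ 2) =
        (∫ r in Ioi (0 : ℝ), (deriv (fun y => w y z) r ^ 2 + deriv (fun z' => w r z') z ^ 2))
          + (3 / 4) * ∫ r in Ioi (0 : ℝ), (r ^ 2)⁻¹ * w r z ^ 2 := fun z =>
    integral_Ioi_gradSq_sqrt_mul_slice (hsliceC z) (hsliceS z) (hsliceT z) (hsliceD z) (hsliceI z)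
  rw [integral_congr_ae (ae_of_all _ hslice)]
  -- the empty-support case: everything vanishes
  by_cases hne : (tsupport W).Nonempty
  swap
  · have hW00 : ∀ r z, w r z = 0 := fun r z => hW0 r z (fun h => hne ⟨_, h⟩)
    have hA0 : ∀ z, (∫ r in Ioi (0 : ℝ), (deriv (fun y => w y z) r ^ 2 + deriv (fun z' => w r z') z ^ 2)) = 0 := by
      intro z; simp [hW00]
    have hB0 : ∀ z, (∫ r in Ioi (0 : ℝ), (r ^ 2)⁻¹ * w r z ^ 2) = 0 := by
      intro z; simp [hW00]
    simp [hA0, hB0]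
  -- a compact R-interval [a, b] ⊂ (0, ∞) containing the radial projection of the support
  have hKrne : Kr.Nonempty := hne.image _
  obtain ⟨a, haK, hamin⟩ := hKrc.exists_isMinOn hKrne continuousOn_id
  obtain ⟨b, hb⟩ := hKrc.bddAbove
  have ha0 : 0 < a := hKr0 haK
  have hKab : Kr ⊆ Icc a b := fun r hr => ⟨hamin hr, hb hr⟩
  -- A: the gradient term, as a parametric integral over [a, b]
  have hA : ∀ z, (∫ r in Ioi (0 : ℝ), (deriv (fun y => w y z) r ^ 2 + deriv (fun z' => w r z') z ^ 2))
      = ∫ r in Icc a b, FA z r := by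
    intro z
    have h1 : (∫ r in Ioi (0 : ℝ), (deriv (fun y => w y z) r ^ 2 + deriv (fun z' => w r z') z ^ 2))
        = ∫ r in Ioi (0 : ℝ), FA z r :=
      setIntegral_congr_fun measurableSet_Ioi fun r _ => by simp [hFA, hdr r z, hdz r z]
    rw [h1]
    refine setIntegral_eq_of_subset_of_forall_sdiff_eq_zero measurableSet_Ioi
      (fun r hr => lt_of_lt_of_le ha0 hr.1) fun r hr => ?_
    have hrK : r ∉ Kr := fun h => hr.2 (hKab h)
    simp [hFA, hfd0 r z (hnotr r z hrK)]
  have hAcont : Continuous fun z => ∫ r in Icc a b, FA z r :=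
    continuous_parametric_integral_of_continuous hFAc isCompact_Icc
  have hAsupp : HasCompactSupport fun z => ∫ r in Icc a b, FA z r := by
    refine HasCompactSupport.intro hKzc fun z hz => ?_
    have : ∀ r, FA z r = 0 := fun r => by simp [hFA, hfd0 r z (hnotz r z hz)]
    simp [this]
  have hAint : Integrable fun z =>
      ∫ r in Ioi (0 : ℝ), (deriv (fun y => w y z) r ^ 2 + deriv (fun z' => w r z') z ^ 2) := by
    rw [show (fun z => ∫ r in Ioi (0 : ℝ), (deriv (fun y => w y z) r ^ 2 + deriv (fun z' => w r z') z ^ 2))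
        = fun z => ∫ r in Icc a b, FA z r from funext hA]
    exact hAcont.integrable_of_hasCompactSupport hAsupp
  -- B: the potential term, with the weight regularised away from R = 0 (equal on [a, b])
  set FB : ℝ → ℝ → ℝ := fun z r => ((max r a) ^ 2)⁻¹ * w r z ^ 2 with hFB
  have hFBc : Continuous (Function.uncurry FB) := by
    have hm : Continuous fun p : ℝ × ℝ => ((max p.2 a) ^ 2)⁻¹ := by
      refine ((continuous_snd.max continuous_const).pow 2).inv₀ fun p => ?_
      exact pow_ne_zero 2 (ne_of_gt (lt_of_lt_of_le ha0 (le_max_right _ _)))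
    have hwc : Continuous fun p : ℝ × ℝ => w p.2 p.1 := hw.continuous.comp (continuous_snd.prodMk continuous_fst)
    exact hm.mul (hwc.pow 2)
  have hB : ∀ z, (∫ r in Ioi (0 : ℝ), (r ^ 2)⁻¹ * w r z ^ 2) = ∫ r in Icc a b, FB z r := by
    intro z
    have h1 : (∫ r in Ioi (0 : ℝ), (r ^ 2)⁻¹ * w r z ^ 2) = ∫ r in Icc a b, (r ^ 2)⁻¹ * w r z ^ 2 := by
      refine setIntegral_eq_of_subset_of_forall_sdiff_eq_zero measurableSet_Ioi
        (fun r hr => lt_of_lt_of_le ha0 hr.1) fun r hr => ?_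
      have hrK : r ∉ Kr := fun h => hr.2 (hKab h)
      simp [hW0 r z (hnotr r z hrK)]
    rw [h1]
    exact setIntegral_congr_fun measurableSet_Icc fun r hr => by simp [hFB, max_eq_left hr.1]
  have hBcont : Continuous fun z => ∫ r in Icc a b, FB z r :=
    continuous_parametric_integral_of_continuous hFBc isCompact_Icc
  have hBsupp : HasCompactSupport fun z => ∫ r in Icc a b, FB z r := by
    refine HasCompactSupport.intro hKzc fun z hz => ?_
    have : ∀ r, FB z r = 0 := fun r => by simp [hFB, hW0 r z (hnotz r z hz)]
    simp [this]
  have hBint : Integrable fun z => ∫ r in Ioi (0 : ℝ), (r ^ 2)⁻¹ * w r z ^ 2 := by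
    rw [show (fun z => ∫ r in Ioi (0 : ℝ), (r ^ 2)⁻¹ * w r z ^ 2) = fun z => ∫ r in Icc a b, FB z r
        from funext hB]
    exact hBcont.integrable_of_hasCompactSupport hBsupp
  -- linearity of the Z-integral
  rw [integral_add hAint (hBint.const_mul (3 / 4)), integral_const_mul]

end GradShafranovSqrt

end Literature.MathematicalPhysics.MHD
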